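import Mathlib.Analysis.SpecialFunctions.Complex.CircleAddChar
import Mathlib.NumberTheory.LegendreSymbol.AddCharacter

/-!
# The modulus of a quadratic Gauss sum with an odd denominator

For an odd modulus `m`, a unit `a` of `ZMod m` and any `b`,
`‖∑_{x ∈ ℤ_m} ψ(a x² + b x)‖² = m`, where `ψ = ZMod.stdAddChar` is the standard additive character
`x ↦ exp(2πi x/m)` of `ZMod m`.

Source: N. M. Korobov, *Exponential sums and their applications* (Kluwer, 1992), Ch. I §3,
Theorem 3 (`|S(q)| = √q` for odd `q`, `(a, q) = 1`) together with eq. (41) there (the sum "of the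
general form" `∑ e((a₁ x + a₂ x²)/q)` under `(2a₂, q) = 1`). [Korobov1992]

Proof (Korobov's, loc. cit., eq. (39)–(40)): `|S|² = ∑_x ∑_y ψ(g(y) - g(x))`; substitute `y = x + h`;
`g(x+h) - g(x) = (a h² + b h) + x·(2 a h)`; the inner sum over `x` is `m·[2 a h = 0]` by orthogonality of
the primitive character `ψ` (`AddChar.sum_mulShift`); since `m` is odd, `2a` is a unit and only `h = 0`
survives.

What is NOT here: the VALUE of the Gauss sum (the sign / `i^{((q-1)/2)²}` of Korobov's Theorem 4 and
eq. (52)), even moduli (`|S| = √(2q)` or `0`), and prime-modulus results already in the tree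
(`Literature/NumberTheory/Sieve/HyperKloostermanPrimePower.lean`, `norm_sum_sum_stdAddChar_quadratic`,
binary forms modulo a prime) or in Mathlib (`gaussSum` for a multiplicative character twisted by an
additive one, `gaussSum_mul_gaussSum_eq_card`).  This file treats an arbitrary odd modulus, which is what
the application in `Literature/Computability/Cryptography/ChenQuantumLWEProductProofs.lean` needs
(`m = p₂⋯p_κ`, a product of distinct odd primes).
-/

namespace Literature.NumberTheory.GaussSums

open scoped BigOperators

/-- `2` is a unit of `ZMod m` when `m` is odd. [folklore] -/
theorem isUnit_two_zmod_of_odd (m : ℕ) (hm : Odd m) : IsUnit (2 : ZMod m) := by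
  have h2' : IsUnit ((2 : ℕ) : ZMod m) :=
    (ZMod.isUnit_iff_coprime 2 m).2 (Nat.coprime_two_left.2 hm)
  rwa [Nat.cast_ofNat] at h2'

/-- **Autocorrelation identity for a quadratic Gauss sum** (Korobov 1992, Ch. I §3, eq. (39), for a
general quadratic polynomial): with `S = ∑_x ψ(a x² + b x)`,
`conj S · S = ∑_h ψ(a h² + b h) · (m · [2 a h = 0])`. [cite: Korobov1992, Ch. I §3 eq. (39)] -/
theorem conj_mul_sum_stdAddChar_quadratic (m : ℕ) [NeZero m] (a b : ZMod m) :
    (starRingEnd ℂ) (∑ x : ZMod m, ZMod.stdAddChar (a * x ^ 2 + b * x))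
        * ∑ x : ZMod m, ZMod.stdAddChar (a * x ^ 2 + b * x)
      = ∑ h : ZMod m, ZMod.stdAddChar (a * h ^ 2 + b * h)
          * ((if 2 * a * h = 0 then Fintype.card (ZMod m) else 0 : ℕ) : ℂ) := by
  set ψ := ZMod.stdAddChar (N := m) with hψ
  calc (starRingEnd ℂ) (∑ x : ZMod m, ψ (a * x ^ 2 + b * x)) * ∑ x : ZMod m, ψ (a * x ^ 2 + b * x)
      = ∑ x, ∑ y, (starRingEnd ℂ) (ψ (a * x ^ 2 + b * x)) * ψ (a * y ^ 2 + b * y) := by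
        rw [map_sum, Finset.sum_mul_sum]
    _ = ∑ x, ∑ y, ψ ((a * y ^ 2 + b * y) - (a * x ^ 2 + b * x)) := by
        refine Finset.sum_congr rfl fun x _ => Finset.sum_congr rfl fun y _ => ?_
        rw [← AddChar.map_neg_eq_conj, ← AddChar.map_add_eq_mul]
        congr 1
        ring
    _ = ∑ x, ∑ h, ψ ((a * (x + h) ^ 2 + b * (x + h)) - (a * x ^ 2 + b * x)) := by
        refine Finset.sum_congr rfl fun x _ => ?_
        exact (Fintype.sum_equiv (Equiv.addLeft x)
          (fun h => ψ ((a * (x + h) ^ 2 + b * (x + h)) - (a * x ^ 2 + b * x)))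
          (fun y => ψ ((a * y ^ 2 + b * y) - (a * x ^ 2 + b * x))) (fun h => rfl)).symm
    _ = ∑ x, ∑ h, ψ (a * h ^ 2 + b * h) * ψ (x * (2 * a * h)) := by
        refine Finset.sum_congr rfl fun x _ => Finset.sum_congr rfl fun h _ => ?_
        rw [← AddChar.map_add_eq_mul]
        congr 1
        ring
    _ = ∑ h, ψ (a * h ^ 2 + b * h) * ∑ x, ψ (x * (2 * a * h)) := by
        rw [Finset.sum_comm]
        refine Finset.sum_congr rfl fun h _ => ?_
        rw [Finset.mul_sum]
    _ = ∑ h, ψ (a * h ^ 2 + b * h)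
          * ((if 2 * a * h = 0 then Fintype.card (ZMod m) else 0 : ℕ) : ℂ) := by
        refine Finset.sum_congr rfl fun h _ => ?_
        rw [AddChar.sum_mulShift _ (ZMod.isPrimitive_stdAddChar m)]

/-- **The quadratic Gauss sum with odd denominator has modulus `√m`** (Korobov 1992, Ch. I §3,
Theorem 3 with eq. (41)): for `m` odd, `a` a unit of `ZMod m` and any `b`,
`‖∑_{x ∈ ℤ_m} ψ(a x² + b x)‖² = m`. [cite: Korobov1992, Ch. I §3 Thm 3, eq. (41)] -/
theorem norm_sq_sum_stdAddChar_quadratic (m : ℕ) [NeZero m] (hm : Odd m) (a b : ZMod m)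
    (ha : IsUnit a) :
    ‖∑ x : ZMod m, ZMod.stdAddChar (a * x ^ 2 + b * x)‖ ^ 2 = m := by
  set S := ∑ x : ZMod m, ZMod.stdAddChar (a * x ^ 2 + b * x) with hS
  have h2 : IsUnit (2 * a) := (isUnit_two_zmod_of_odd m hm).mul ha
  have key : (starRingEnd ℂ) S * S = (m : ℂ) := by
    rw [hS, conj_mul_sum_stdAddChar_quadratic]
    calc ∑ h : ZMod m, ZMod.stdAddChar (a * h ^ 2 + b * h)
            * ((if 2 * a * h = 0 then Fintype.card (ZMod m) else 0 : ℕ) : ℂ)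
        = ∑ h : ZMod m, (if h = 0 then (m : ℂ) else 0) := by
          refine Finset.sum_congr rfl fun h _ => ?_
          rw [ZMod.card m]
          by_cases hh : h = 0
          · subst hh
            simp
          · have hne : 2 * a * h ≠ 0 := fun h0 => hh ((h2.mul_right_eq_zero).1 h0)
            simp [hh, hne]
      _ = (m : ℂ) := by simp
  have h3 : ((‖S‖ : ℂ)) ^ 2 = (m : ℂ) := by
    rw [← Complex.conj_mul']
    exact key
  exact_mod_cast h3

/-- The same with the modulus itself: `‖∑_x ψ(a x² + b x)‖ = √m`.
[cite: Korobov1992, Ch. I §3 Thm 3, eq. (41)] -/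
theorem norm_sum_stdAddChar_quadratic (m : ℕ) [NeZero m] (hm : Odd m) (a b : ZMod m)
    (ha : IsUnit a) :
    ‖∑ x : ZMod m, ZMod.stdAddChar (a * x ^ 2 + b * x)‖ = Real.sqrt m := by
  rw [← norm_sq_sum_stdAddChar_quadratic m hm a b ha, Real.sqrt_sq (norm_nonneg _)]

end Literature.NumberTheory.GaussSums
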